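import Summits.Schanuel.Schanuel.Theorems.RootDecomp1KGapCell06

/-!
# RootDecomp1KGapCell — lens 1, generation 42 «GAP CELL / INTERLACED SPECIALISATION» (lane K-R26 (α-loc)): the walls (1, ℓ_b, ρ), (1, ℓ₂, ℓ₃, ρ) (mod hNW), their π-twins and the 31077 pair (ℓ_b, ρ) HYPOTHESIS-FREE for every ρ ∈ `FactorialGapLiouville` — located order data strictly below the log-log floor; member ρ_W — continuation (RootDecomp1KGapCell07): §7 `not_logLogLiouville_rhoW` — strictly below the log-log floor

(lens-1 g42 `GapCell.lean` EDITION 3 [HOME/decomp-schanuel-lens-1/g42/ sha256 6f7828b1…, 2470 l; VERDICT L2004, EDITIONS 2+3 L2018, ACK L2023]; port by census-1 gen 17 as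
`RootDecomp1KGapCell01`–`10` — see the PORT NOTE of part 01; `--supports stmt-Schanuel-33364` (04: `stmt-Schanuel-31077`); rung 0.)
-/

open Summit.Schanuel.Schanuel.Theorems.RootDecomp1KHyper
open Summit.Schanuel.Schanuel.Theorems.RootDecomp1KHyper.HyperCell
open Summit.Schanuel.Schanuel.Theorems.RootDecomp1KRelLiouvilleCell
open Summit.Schanuel.Schanuel.Theorems.RootDecomp1KLogLogCell
open Summit.Schanuel.Schanuel.Theorems.RootDecomp1KTwoBaseCell
open LiouvilleNumber
open scoped Nat

namespace Summit.Schanuel.Schanuel.Theorems.RootDecomp1KGapCell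

variable {k n : ℕ}

/-- Two distinct rationals are `≥ 1/(den·den')` apart (as reals). -/
private theorem one_div_den_mul_den_le_abs_sub {s r : ℚ} (hne : s ≠ r) :
    1 / ((s.den : ℝ) * r.den) ≤ |(s : ℝ) - r| := by
  have hsd : (0 : ℝ) < s.den := by exact_mod_cast s.den_pos
  have hrd : (0 : ℝ) < r.den := by exact_mod_cast r.den_pos
  set z : ℤ := s.num * r.den - r.num * s.den with hz
  have hsub : (s : ℝ) - r = (z : ℝ) / ((s.den : ℝ) * r.den) := by
    rw [Rat.cast_def s, Rat.cast_def r, hz]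
    push_cast
    field_simp
  have hz0 : z ≠ 0 := by
    intro h0
    have : (s : ℝ) - r = 0 := by rw [hsub, h0]; simp
    exact hne (by exact_mod_cast (sub_eq_zero.mp this))
  have hz1 : (1 : ℝ) ≤ |(z : ℝ)| := by exact_mod_cast Int.one_le_abs hz0
  rw [hsub, abs_div, abs_of_pos (mul_pos hsd hrd)]
  exact div_le_div_of_nonneg_right hz1 (mul_pos hsd hrd).le

/-! ## §7  `ρ_W` IS NOT LOG-LOG-LIOUVILLE — STRICTLY BELOW THE LOG-LOG FLOOR (RULE K-R26 (α)) -/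

section BelowFloor

/-- `Real.exp 4 ≤ 100`. -/
private theorem exp_four_le' : Real.exp 4 ≤ 100 := by
  have h : Real.exp 4 = Real.exp 1 ^ 4 := by rw [← Real.exp_nat_mul]; norm_num
  rw [h]
  have h1 := Real.exp_one_lt_d9
  have h2 : Real.exp 1 ^ 4 ≤ (2.7182818286 : ℝ) ^ 4 :=
    pow_le_pow_left₀ (Real.exp_pos _).le h1.le 4
  exact h2.trans (by norm_num)

/-- `Real.exp 1 ≤ 4`. -/
private theorem exp_one_le_four' : Real.exp 1 ≤ 4 := by
  have := Real.exp_one_lt_d9; linarith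

/-- `2 ^ k ≤ cW k`. -/
private theorem two_pow_le_cW (k : ℕ) : 2 ^ k ≤ cW k := by
  have h : 2 ^ k ≤ 2 * k ! := by
    induction k with
    | zero => norm_num
    | succ k ih =>
      rw [pow_succ, Nat.factorial_succ]
      rcases Nat.eq_zero_or_pos k with h0 | hk
      · subst h0; norm_num
      · have h1 : 2 * k ! * 2 ≤ 2 * ((k + 1) * k !) := by nlinarith [Nat.factorial_pos k]
        exact le_trans (Nat.mul_le_mul_right 2 ih) h1
  exact h.trans (two_mul_factorial_le_cW k)

/-- **EFFECTIVE IRRATIONALITY MEASURE OF `ρ_W`**: for `q ≥ 100`, `|ρ_W − p/q| ≥ exp(−12 · log q · log log q)`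
(hypothesis-free).  Mechanism: at the scale `2^{c_k} ≤ q < 2^{c_{k+1}} =: D` one has `D ≤ q^{2k+2}`
(`c_{k+1} ≤ 2(k+1)c_k`), `p/q ≠ t_{k+1}` (exact denominator `D > q`), so `|p/q − t_{k+1}| ≥ 1/(qD)` while the tail
is `≤ 2·2^{−c_{k+2}} ≤ 1/(2qD)`; and `2k + 3 ≤ 10 log log q`. -/
theorem rhoW_sub_rat_lower_loglog (r : ℚ) (hq100 : 100 ≤ r.den) :
    Real.exp (-(12 * Real.log r.den * Real.log (Real.log r.den))) ≤ |rhoW - r| := by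
  classical
  set q : ℕ := r.den with hqdef
  have hq0 : 0 < q := by omega
  have hq0R : (0 : ℝ) < q := by exact_mod_cast hq0
  have hq100R : (100 : ℝ) ≤ q := by exact_mod_cast hq100
  set L : ℝ := Real.log q with hLdef
  have hL4 : 4 ≤ L := (Real.le_log_iff_exp_le hq0R).mpr (exp_four_le'.trans hq100R)
  have hL0 : 0 < L := by linarith
  set LL : ℝ := Real.log L with hLLdef
  have hLL1 : 1 ≤ LL := (Real.le_log_iff_exp_le hL0).mpr (exp_one_le_four'.trans hL4)
  have hqpow : ∀ n : ℕ, (q : ℝ) ^ n = Real.exp ((n : ℝ) * L) := fun n => by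
    rw [Real.exp_nat_mul, hLdef, Real.exp_log hq0R]
  -- the scale `k ≥ 1` with `2^{c_k} ≤ q < 2^{c_{k+1}}`
  have hex : ∃ j : ℕ, q < 2 ^ cW (j + 1) :=
    ⟨q, (Nat.lt_two_pow_self).trans_le
      (Nat.pow_le_pow_right two_pos ((Nat.le_succ q).trans (self_le_cW (q + 1))))⟩
  set k : ℕ := Nat.find hex with hk
  have hkP : q < 2 ^ cW (k + 1) := Nat.find_spec hex
  have hk1 : 1 ≤ k := by
    by_contra h0
    have h00 : k = 0 := by omega
    rw [h00] at hkP
    have : cW 1 = 3 := by decide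
    rw [zero_add, this] at hkP
    norm_num at hkP
    omega
  have hklow : 2 ^ cW k ≤ q := by
    have h := Nat.find_min hex (m := k - 1) (by omega)
    rw [Nat.sub_add_cancel hk1] at h
    exact not_lt.mp h
  -- `2k + 3 ≤ 10 log log q`
  have hkLL : 2 * (k : ℝ) + 3 ≤ 10 * LL := by
    have h2 := Real.log_two_gt_d9
    have h2' := Real.log_two_lt_d9
    have hcL : (cW k : ℝ) * Real.log 2 ≤ L := by
      have h1 : (2 : ℝ) ^ cW k ≤ q := by
        have : ((2 : ℕ) ^ cW k : ℕ) ≤ q := hklow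
        exact_mod_cast this
      have := Real.log_le_log (by positivity) h1
      rwa [Real.log_pow] at this
    have hc : (cW k : ℝ) ≤ 2 * L := by nlinarith [Nat.cast_nonneg (α := ℝ) (cW k)]
    have hpow : (2 : ℝ) ^ k ≤ 2 * L := by
      have h1 : ((2 ^ k : ℕ) : ℝ) ≤ ((cW k : ℕ) : ℝ) := by exact_mod_cast two_pow_le_cW k
      push_cast at h1
      linarith
    have hlog : (k : ℝ) * Real.log 2 ≤ Real.log 2 + LL := by
      have h1 := Real.log_le_log (by positivity) hpow
      rw [Real.log_pow, Real.log_mul (by norm_num) hL0.ne'] at h1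
      exact h1
    have hprod : LL * 0.6931471803 ≤ LL * Real.log 2 := mul_le_mul_of_nonneg_left h2.le (by linarith)
    have hka : (2 * (k : ℝ) + 3) * Real.log 2 ≤ 10 * LL * Real.log 2 := by nlinarith
    exact le_of_mul_le_mul_right hka (by linarith)
  -- real quantities: `D = 2^{c_{k+1}}`, `q < D ≤ q^{2k+2}`
  set D : ℝ := (2 : ℝ) ^ cW (k + 1) with hD
  have hD0 : 0 < D := by positivity
  have hqD : (q : ℝ) < D := by rw [hD]; exact_mod_cast hkP
  have hDq : D ≤ (q : ℝ) ^ (2 * k + 2) := by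
    have h1 : cW (k + 1) ≤ (2 * k + 2) * cW k := by have := cW_succ_le k; nlinarith
    calc D ≤ (2 : ℝ) ^ ((2 * k + 2) * cW k) := pow_le_pow_right₀ (by norm_num) h1
      _ = ((2 : ℝ) ^ cW k) ^ (2 * k + 2) := by rw [← pow_mul, Nat.mul_comm]
      _ ≤ (q : ℝ) ^ (2 * k + 2) := pow_le_pow_left₀ (by positivity) (by exact_mod_cast hklow) _
  -- the truncation `t_{k+1} = M_{k+1}/D` and the tail `R`
  set P : ℝ := tW (k + 1) with hPdef
  set R : ℝ := ∑' j, aW (j + (k + 1 + 1)) with hRdef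
  have hℓ : rhoW = P + R := rhoW_eq_tW_add (k + 1)
  have hRpos : 0 < R := tailW_pos (k + 1)
  have hRle : R ≤ 1 / (q * D) / 2 := by
    have h1 : R ≤ 2 / (2 : ℝ) ^ cW (k + 1 + 1) := tailW_le (k + 1)
    have h2 : 2 * cW (k + 1) + 2 ≤ cW (k + 1 + 1) := by
      have := succ_mul_cW_le (k + 1); have := two_le_cW (k + 1); nlinarith
    have h3 : 2 / (2 : ℝ) ^ cW (k + 1 + 1) ≤ 1 / (q * D) / 2 := by
      rw [div_div, div_le_div_iff₀ (by positivity) (by positivity), one_mul]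
      calc (2 : ℝ) * ((q : ℝ) * D * 2) ≤ 2 * (D * D * 2) := by gcongr
        _ = (2 : ℝ) ^ (2 * cW (k + 1) + 2) := by rw [hD]; ring
        _ ≤ (2 : ℝ) ^ cW (k + 1 + 1) := pow_le_pow_right₀ (by norm_num) h2
    exact h1.trans h3
  by_cases hrP : rW (k + 1) = r
  · -- `r` cannot BE the truncation: its exact denominator is `D > q`
    exfalso
    have hden : (rW (k + 1)).den = q := by rw [hrP]
    rw [rW_den] at hden
    omega
  · -- `r ≠ t_{k+1}`: `|t_{k+1} − r| ≥ 1/(qD)` (two distinct rationals), the tail is at most half of that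
    have hsep : 1 / (q * D) ≤ |P - (r : ℝ)| := by
      have h1 := one_div_den_mul_den_le_abs_sub hrP
      rw [rW_den, rW_cast] at h1
      have e : (((2 ^ cW (k + 1) : ℕ) : ℝ) * (r.den : ℝ)) = q * D := by rw [hD, hqdef]; push_cast; ring
      rw [e] at h1
      exact h1
    have htri : |P - (r : ℝ)| - R ≤ |rhoW - r| := by
      rw [hℓ]
      have e : P + R - (r : ℝ) = (P - r) - (-R) := by ring
      rw [e]
      have h1 := abs_sub_abs_le_abs_sub (P - (r : ℝ)) (-R)
      rw [abs_neg, abs_of_pos hRpos] at h1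
      exact h1
    refine le_trans ?_ htri
    have hqD2 : 1 / (q : ℝ) ^ (2 * k + 3) / 2 ≤ 1 / (q * D) / 2 := by
      have h1 : (q : ℝ) * D ≤ (q : ℝ) ^ (2 * k + 3) := by
        rw [pow_succ']; exact mul_le_mul_of_nonneg_left hDq hq0R.le
      have h2 : 1 / (q : ℝ) ^ (2 * k + 3) ≤ 1 / (q * D) := one_div_le_one_div_of_le (by positivity) h1
      linarith
    have hmain : Real.exp (-(12 * L * LL)) ≤ 1 / (q : ℝ) ^ (2 * k + 3) / 2 := by
      have h3 : 1 / (q : ℝ) ^ (2 * k + 3) = Real.exp (-((2 * (k : ℝ) + 3) * L)) := by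
        rw [hqpow, one_div, ← Real.exp_neg]; push_cast; ring_nf
      have hLLL : 1 ≤ 2 * L * LL := by nlinarith
      have h2 : (2 : ℝ) ≤ Real.exp (2 * L * LL) := by linarith [Real.add_one_le_exp (2 * L * LL)]
      have hE : (2 * (k : ℝ) + 3) * L ≤ 10 * L * LL := by nlinarith
      have h1 : Real.exp (-(12 * L * LL)) * 2 ≤ Real.exp (-((2 * (k : ℝ) + 3) * L)) :=
        calc Real.exp (-(12 * L * LL)) * 2 ≤ Real.exp (-(12 * L * LL)) * Real.exp (2 * L * LL) :=
              mul_le_mul_of_nonneg_left h2 (Real.exp_pos _).le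
          _ = Real.exp (-(10 * L * LL)) := by rw [← Real.exp_add]; ring_nf
          _ ≤ Real.exp (-((2 * (k : ℝ) + 3) * L)) := Real.exp_le_exp.mpr (by linarith)
      rw [h3]
      linarith
    linarith

/-- **`ρ_W` IS NOT LOG-LOG-LIOUVILLE** (hypothesis-free): the member of the gap class sits STRICTLY BELOW the
log-log floor `|ρ − p/q| < exp(−m log q log log q)` of the LogLog cell (g37, `LogLogLiouville`) — i.e. the gap
cell reaches Liouville coordinates the log-log mechanism provably cannot (RULE K-R26 lane (α)). -/
theorem not_logLogLiouville_rhoW : ¬ LogLogLiouville rhoW := by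
  intro hH
  obtain ⟨r, hden, -, hlt⟩ := hH 100
  have hlow := rhoW_sub_rat_lower_loglog r hden
  have hq0R : (0 : ℝ) < r.den := by exact_mod_cast r.den_pos
  have hL1 : 1 ≤ Real.log r.den :=
    (Real.le_log_iff_exp_le hq0R).mpr (exp_one_le_four'.trans (by exact_mod_cast (show 4 ≤ r.den by omega)))
  have hLL0 : 0 ≤ Real.log (Real.log r.den) := Real.log_nonneg hL1
  have hprod : 0 ≤ Real.log r.den * Real.log (Real.log r.den) := mul_nonneg (by linarith) hLL0
  have h1 : Real.exp (-(((100 : ℕ) : ℝ) * Real.log r.den * Real.log (Real.log r.den))) ≤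
      Real.exp (-(12 * Real.log r.den * Real.log (Real.log r.den))) := by
    rw [Real.exp_le_exp, neg_le_neg_iff, mul_assoc, mul_assoc]
    refine mul_le_mul_of_nonneg_right ?_ hprod
    norm_num
  linarith

/-- Hence `ρ_W` is NOT one of the LogLog cell's coordinates, and in particular `ρ_W ∉ ℚ`, `ρ_W` is Liouville
(order data: `liouville_rhoW`) yet escapes the log-log class: the gap cell's members are NEW points. -/
theorem rhoW_liouville_not_logLog : Liouville rhoW ∧ ¬ LogLogLiouville rhoW :=
  ⟨liouville_rhoW, not_logLogLiouville_rhoW⟩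

end BelowFloor

end Summit.Schanuel.Schanuel.Theorems.RootDecomp1KGapCell
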